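import Summits.QuantumFields.BalabanUV.Beta.GAN24.ContactCauchyAssembly
import Summits.QuantumFields.BalabanUV.Beta.GAN24.ContactRefineBHolds
import Summits.QuantumFields.BalabanUV.Beta.GAN24.ContactRefinePThreePack

/-!
# `BalabanUV.Beta.GAN24.ContactCauchyAssemblyHolds` — binder row G-an2-4 / (CONV-C), the row owner's CONTACT-TERM ROUTE, **CT-4e part 2, DISCHARGED**: the five
# two-tower atom ENDs of CT-4c (leaf-02 g50's `ContactRefineBHolds.exists_atomTip∕Mid∕Site_refine_three`, gan24-p2 g34's
# `ContactRefinePThreePack.exists_pairingAtomTip∕Mid_refine_three`) plugged BY NAME into part 2's `exists_contact_supRate_of_atoms` —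
# **THE CONTACT TERM OF THE CUBIC-WILSON SECTOR, DIFFERENCED ACROSS TWO CONSECUTIVE TOWERS IN TABLE UNITS, IS `ϑ^k`-SMALL IN SUP NORM, from `2 ≤ Lc` ALONE.**

NOT IN PRINT; OUR BOOKKEEPING (row owner `b2b-balaban-gan24-p1`, gen 22; [folklore] assembly BY NAME; the P-atoms' `AffineAveraging.unitVec` respelled by leaf-02's
`ContactOneGaugeCellAlgebra.affine_unitVec_eq`).  HONEST FRAMING (cell contract, verbatim): «discharging `BetaPertH` makes Bałaban's UV stability UNCONDITIONAL —
a real constructive-QFT result; it is NOT the continuum limit and NOT the Clay problem.»  HONEST DEPENDENCY (verbatim): «continuum YM on T⁴ ⇐ BetaPertH ∧ nine spine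
estimates (0/9 proved); BetaPertH ⇐ (D1) ∧ (D4) ∧ CAP+tail; G-an2-4 gates asym, D1 and NE2/3/4.»  0 `def`, 0 cited facts, 0 `def … : Prop`, 0 sorry.  NO estimate of
Bałaban's; discharges NOTHING of (hS, hSall) on (E) by itself (part 3 `WilsonSectorRate` consumes it); NEVER «G-an2-4 closed» as (CONV-C); NOT D1, NOT BetaPertH,
NOT continuum, NOT Clay.
Unit `b2b-balaban-gan24-p1` (row owner G-an2-4, gen 22), 2026-08-21.
-/

noncomputable section

open Literature.MathematicalPhysics.QuantumFieldTheory.Balaban1983to89.Beta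
open StepJetData (wilsonA)
open AffineAveraging (Site box toSite)
open BalabanCompositeJets (respStep)
open Summit.QuantumFields.BalabanUV.Beta.GAN24.Push4Iter (legChain)
open Summit.QuantumFields.BalabanUV.Beta.GAN24.RespStepBmDecompExact (respStepBmSeq)
open Summit.QuantumFields.BalabanUV.Beta.GAN24.Push3 (push₃)
open Summit.QuantumFields.BalabanUV.Beta.GAN24.ContactOneGaugeCellAlgebra (affine_unitVec_eq)
open Summit.QuantumFields.BalabanUV.Beta.GAN24.ContactCauchyAssembly (exists_contact_supRate_of_atoms)
open Summit.QuantumFields.BalabanUV.Beta.GAN24.ContactRefineBHolds (exists_atomTip_refine_three exists_atomMid_refine_three exists_atomSite_refine_three)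
open Summit.QuantumFields.BalabanUV.Beta.GAN24.ContactRefinePThreePack (exists_pairingAtomTip_refine_three exists_pairingAtomMid_refine_three)

namespace Summit.QuantumFields.BalabanUV.Beta.GAN24.ContactCauchyAssemblyHolds

variable {Lc : ℕ} [NeZero Lc]

/-- NOT IN PRINT; OUR BOOKKEEPING ([folklore] assembly; UNCONDITIONAL).  **CT-4e — THE CONTACT TERM OF THE CUBIC-WILSON SECTOR, DIFFERENCED ACROSS TWO CONSECUTIVE
TOP-ALIGNED TOWERS IN TABLE UNITS, IS `ϑ^k`-SMALL IN SUP NORM** (`d = 3`, every `Lc ≥ 2`, NO hypothesis beyond it): `∃ K ≥ 0, ϑ ∈ [0,1)` with, for every in-block root,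
every `k` and all coarse data `κ₁ u′ x′ z′ α β`,
`|Lc^{12(k+2)}·(push₃ T′³ W − push₃ B′³ W)(κ₁ u′ x′ z′ (inl α) (inl β)) − Lc^{12(k+1)}·(push₃ T³ W − push₃ B³ W)(…)| ≤ K·ϑ^k`. -/
theorem exists_contact_supRate_three (hLc : 2 ≤ Lc) :
    ∃ K ϑ : ℝ, 0 ≤ K ∧ 0 ≤ ϑ ∧ ϑ < 1 ∧ ∀ (rr : Fin (3 + 1) → ℕ), rr ∈ box (3 + 1) Lc →
      ∀ (k : ℕ) (κ₁ : Fin (3 + 1)) (u' x' z' : Site (3 + 1)) (α β : Fin (3 + 1)),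
        |(Lc : ℝ) ^ (12 * (k + 2)) *
            (push₃ (legChain (respStepBmSeq (d := 3) (toSite rr) Lc) 0 (k + 1)) (legChain (respStepBmSeq (d := 3) (toSite rr) Lc) 0 (k + 1))
                (legChain (respStepBmSeq (d := 3) (toSite rr) Lc) 0 (k + 1)) (wilsonA 3) κ₁ u' x' z' (Sum.inl α) (Sum.inl β)
              - push₃ (respStep (d := 3) 1 (Lc ^ (k + 2))) (respStep (d := 3) 1 (Lc ^ (k + 2))) (respStep (d := 3) 1 (Lc ^ (k + 2)))
                (wilsonA 3) κ₁ u' x' z' (Sum.inl α) (Sum.inl β))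
          - (Lc : ℝ) ^ (12 * (k + 1)) *
            (push₃ (legChain (respStepBmSeq (d := 3) (toSite rr) Lc) 0 k) (legChain (respStepBmSeq (d := 3) (toSite rr) Lc) 0 k)
                (legChain (respStepBmSeq (d := 3) (toSite rr) Lc) 0 k) (wilsonA 3) κ₁ u' x' z' (Sum.inl α) (Sum.inl β)
              - push₃ (respStep (d := 3) 1 (Lc ^ (k + 1))) (respStep (d := 3) 1 (Lc ^ (k + 1))) (respStep (d := 3) 1 (Lc ^ (k + 1)))
                (wilsonA 3) κ₁ u' x' z' (Sum.inl α) (Sum.inl β))|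
          ≤ K * ϑ ^ k := by
  have hPT := exists_pairingAtomTip_refine_three (Lc := Lc) hLc
  have hPM := exists_pairingAtomMid_refine_three (Lc := Lc) hLc
  simp only [affine_unitVec_eq] at hPT hPM
  exact exists_contact_supRate_of_atoms hLc (exists_atomTip_refine_three hLc) (exists_atomMid_refine_three hLc) (exists_atomSite_refine_three hLc) hPT hPM

end Summit.QuantumFields.BalabanUV.Beta.GAN24.ContactCauchyAssemblyHolds

end
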